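import Summits.KontsevichZagierPeriods.KontsevichZagierPeriods.Theses.PhiFourHepp
import Literature.NumberTheory.Transcendental.KZKernelConjectureForms

/-!
# Redirect strategist r1 — crux `TropicalLifting` (stmt-KontsevichZagierPeriods-12289): position lemmas and the typed split

`T` = `TropicalLifting` (route PhiFourHepp, rank 4), `S` = `KontsevichZagierPeriods`.
* `HeppBackward` (HB): Panzer 2022 Conj. 1.2 (⇐) on the typed class — equal inlined Hepp sums ⇒ equal VALUES (same binders as T).
* `PhiFourValueSector` (ΦP): Conjecture 1 on the φ⁴ parametric sector — equal values ⇒ KZ-equivalent (same binders as T).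
Seams: `T → HB` (soundness), `HB → ΦP → T` (modus ponens), `S → ΦP` (sector of the summit), hence `S → (T ↔ HB)`:
modulo the summit, T is exactly Panzer's conjecture (⇐); modulo Panzer's conjecture, T is exactly the φ⁴ sector of S.
-/

namespace Summit.KontsevichZagierPeriods.KontsevichZagierPeriods.Cruxes.TropicalLifting.RedirectR1

open Summit.KontsevichZagierPeriods.KontsevichZagierPeriods.Theses.PhiFourHepp
open Literature.NumberTheory.Transcendental

/-- HB: Panzer 2022 Conj. 1.2 (⇐ half) on the typed class of `TropicalLifting`: equal inlined Hepp flag sums ⇒ equal values. -/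
def HeppBackward : Prop :=
  ∀ (k₁ k₂ : ℕ) (E₁ : Fin (2*k₁+2) → Fin (k₁+2) × Fin (k₁+2)) (E₂ : Fin (2*k₂+2) → Fin (k₂+2) × Fin (k₂+2)), (∀ v, (Finset.univ.filter fun e => (E₁ e).1 = v ∨ (E₁ e).2 = v).card ≤ 4) → (∀ v, (Finset.univ.filter fun e => (E₂ e).1 = v ∨ (E₂ e).2 = v).card ≤ 4) → ∀ (r₁ : Literature.NumberTheory.Transcendental.KZ.IntegralRep (2*k₁+1)) (r₂ : Literature.NumberTheory.Transcendental.KZ.IntegralRep (2*k₂+1)), r₁.domain = {x | ∀ j, 0 < x j} → Set.EqOn r₁.integrand (fun x => 1 / ((Matrix.fromBlocks (Matrix.diagonal (Fin.snoc x (1:ℝ) : Fin (2*k₁+2) → ℝ)) (Matrix.of fun (e : Fin (2*k₁+2)) (j : Fin (k₁+1)) => ((if (E₁ e).1 = j.succ then (1:ℝ) else 0) - (if (E₁ e).2 = j.succ then (1:ℝ) else 0))) (-(Matrix.of fun (e : Fin (2*k₁+2)) (j : Fin (k₁+1)) => ((if (E₁ e).1 = j.succ then (1:ℝ) else 0) -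 (if (E₁ e).2 = j.succ then (1:ℝ) else 0))).transpose) (0 : Matrix (Fin (k₁+1)) (Fin (k₁+1)) ℝ)).det) ^ 2) r₁.domain → r₂.domain = {x | ∀ j, 0 < x j} → Set.EqOn r₂.integrand (fun x => 1 / ((Matrix.fromBlocks (Matrix.diagonal (Fin.snoc x (1:ℝ) : Fin (2*k₂+2) → ℝ)) (Matrix.of fun (e : Fin (2*k₂+2)) (j : Fin (k₂+1)) => ((if (E₂ e).1 = j.succ then (1:ℝ) else 0) - (if (E₂ e).2 = j.succ then (1:ℝ) else 0))) (-(Matrix.of fun (e : Fin (2*k₂+2)) (j : Fin (k₂+1)) => ((if (E₂ e).1 = j.succ then (1:ℝ) else 0) - (if (E₂ e).2 = j.succ then (1:ℝ) else 0))).transpose) (0 : Matrix (Fin (k₂+1)) (Fin (k₂+1)) ℝ)).det) ^ 2) r₂.domain → (∑ c : Fin (k₁+1) → Finset (Fin (2*k₁+2)), if ((∀ i : Fin (k₁+1), (c i).Nonempty ∧ (∀ e ∈ c i, (Matrix.of fun (p : {p // p ∈ (c i).erase e}) (v : Fin (k₁+2)) => ((if (E₁ p.1).1 = v then (1:ℚ)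 else 0) - (if (E₁ p.1).2 = v then (1:ℚ) else 0))).rank = (Matrix.of fun (p : {p // p ∈ c i}) (v : Fin (k₁+2)) => ((if (E₁ p.1).1 = v then (1:ℚ) else 0) - (if (E₁ p.1).2 = v then (1:ℚ) else 0))).rank) ∧ (c i).card - (Matrix.of fun (p : {p // p ∈ c i}) (v : Fin (k₁+2)) => ((if (E₁ p.1).1 = v then (1:ℚ) else 0) - (if (E₁ p.1).2 = v then (1:ℚ) else 0))).rank = i.val + 1) ∧ (∀ i j : Fin (k₁+1), i < j → c i ⊂ c j) ∧ c (Fin.last k₁) = Finset.univ) then ((c 0).card : ℚ) * (∏ i : Fin k₁, (((c i.succ).card : ℚ) - ((c i.castSucc).card : ℚ))) / (∏ i : Fin k₁, (((c i.castSucc).card : ℚ) - 2 * ((i.val : ℚ) + 1))) else 0) = (∑ c : Fin (k₂+1) → Finset (Fin (2*k₂+2)), if ((∀ i : Fin (k₂+1), (c i).Nonempty ∧ (∀ e ∈ c i, (Matrix.of fun (p : {p // p ∈ (c i).erase e}) (v : Fin (k₂+2)) => ((if (E₂ p.1).1 = v then (1:ℚ) else 0) - (if (E₂ p.1).2 = v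 then (1:ℚ) else 0))).rank = (Matrix.of fun (p : {p // p ∈ c i}) (v : Fin (k₂+2)) => ((if (E₂ p.1).1 = v then (1:ℚ) else 0) - (if (E₂ p.1).2 = v then (1:ℚ) else 0))).rank) ∧ (c i).card - (Matrix.of fun (p : {p // p ∈ c i}) (v : Fin (k₂+2)) => ((if (E₂ p.1).1 = v then (1:ℚ) else 0) - (if (E₂ p.1).2 = v then (1:ℚ) else 0))).rank = i.val + 1) ∧ (∀ i j : Fin (k₂+1), i < j → c i ⊂ c j) ∧ c (Fin.last k₂) = Finset.univ) then ((c 0).card : ℚ) * (∏ i : Fin k₂, (((c i.succ).card : ℚ) - ((c i.castSucc).card : ℚ))) / (∏ i : Fin k₂, (((c i.castSucc).card : ℚ) - 2 * ((i.val : ℚ) + 1))) else 0) → r₁.value = r₂.value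

/-- ΦP: the φ⁴ parametric sector of Conjecture 1: equal values ⇒ KZ-equivalent (binders of `TropicalLifting`). -/
def PhiFourValueSector : Prop :=
  ∀ (k₁ k₂ : ℕ) (E₁ : Fin (2*k₁+2) → Fin (k₁+2) × Fin (k₁+2)) (E₂ : Fin (2*k₂+2) → Fin (k₂+2) × Fin (k₂+2)), (∀ v, (Finset.univ.filter fun e => (E₁ e).1 = v ∨ (E₁ e).2 = v).card ≤ 4) → (∀ v, (Finset.univ.filter fun e => (E₂ e).1 = v ∨ (E₂ e).2 = v).card ≤ 4) → ∀ (r₁ : Literature.NumberTheory.Transcendental.KZ.IntegralRep (2*k₁+1)) (r₂ : Literature.NumberTheory.Transcendental.KZ.IntegralRep (2*k₂+1)), r₁.domain = {x | ∀ j, 0 < x j} → Set.EqOn r₁.integrand (fun x => 1 / ((Matrix.fromBlocks (Matrix.diagonal (Fin.snoc x (1:ℝ) : Fin (2*k₁+2) → ℝ)) (Matrix.of fun (e : Fin (2*k₁+2)) (j : Fin (k₁+1)) => ((if (E₁ e).1 = j.succ then (1:ℝ) else 0) - (if (E₁ e).2 = j.succ then (1:ℝ) else 0))) (-(Matrix.of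 fun (e : Fin (2*k₁+2)) (j : Fin (k₁+1)) => ((if (E₁ e).1 = j.succ then (1:ℝ) else 0) - (if (E₁ e).2 = j.succ then (1:ℝ) else 0))).transpose) (0 : Matrix (Fin (k₁+1)) (Fin (k₁+1)) ℝ)).det) ^ 2) r₁.domain → r₂.domain = {x | ∀ j, 0 < x j} → Set.EqOn r₂.integrand (fun x => 1 / ((Matrix.fromBlocks (Matrix.diagonal (Fin.snoc x (1:ℝ) : Fin (2*k₂+2) → ℝ)) (Matrix.of fun (e : Fin (2*k₂+2)) (j : Fin (k₂+1)) => ((if (E₂ e).1 = j.succ then (1:ℝ) else 0) - (if (E₂ e).2 = j.succ then (1:ℝ) else 0))) (-(Matrix.of fun (e : Fin (2*k₂+2)) (j : Fin (k₂+1)) => ((if (E₂ e).1 = j.succ then (1:ℝ) else 0) - (if (E₂ e).2 = j.succ then (1:ℝ) else 0))).transpose) (0 : Matrix (Fin (k₂+1)) (Fin (k₂+1)) ℝ)).det) ^ 2) r₂.domain → r₁.value = r₂.value → Literature.NumberTheory.Transcendental.KZ.Equivalent r₁ r₂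

/-- Seam 1 (soundness): T ⇒ HB. -/
theorem heppBackward_of_tropicalLifting (hT : TropicalLifting) : HeppBackward := by
  intro k₁ k₂ E₁ E₂ hd₁ hd₂ r₁ r₂ hdom₁ hint₁ hdom₂ hint₂ hH
  exact KZ.Equivalent.value_eq_holds (hT k₁ k₂ E₁ E₂ hd₁ hd₂ r₁ r₂ hdom₁ hint₁ hdom₂ hint₂ hH)

/-- Seam 2 (the typed split, assembly): HB ⇒ ΦP ⇒ T. -/
theorem tropicalLifting_of_split (hHB : HeppBackward) (hΦ : PhiFourValueSector) : TropicalLifting := by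
  intro k₁ k₂ E₁ E₂ hd₁ hd₂ r₁ r₂ hdom₁ hint₁ hdom₂ hint₂ hH
  exact hΦ k₁ k₂ E₁ E₂ hd₁ hd₂ r₁ r₂ hdom₁ hint₁ hdom₂ hint₂
    (hHB k₁ k₂ E₁ E₂ hd₁ hd₂ r₁ r₂ hdom₁ hint₁ hdom₂ hint₂ hH)

/-- Seam 3: the summit implies the sector piece ΦP (via the all-representations form `KZPeriodConjecture'`). -/
theorem phiFourValueSector_of_summit (hS : _root_.KontsevichZagierPeriods) : PhiFourValueSector := by
  intro k₁ k₂ E₁ E₂ _ _ r₁ r₂ _ _ _ _ hv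
  exact (kzPeriodConjecture'_iff_isRational.mpr (KontsevichZagierPeriods_iff.mp hS)) r₁ r₂ hv

/-- Position: under the summit, T is EXACTLY Panzer's Conj. 1.2 (⇐) on the typed class. -/
theorem tropicalLifting_iff_heppBackward_of_summit (hS : _root_.KontsevichZagierPeriods) :
    TropicalLifting ↔ HeppBackward :=
  ⟨heppBackward_of_tropicalLifting, fun h => tropicalLifting_of_split h (phiFourValueSector_of_summit hS)⟩

/-- Position: under Panzer's Conj. 1.2 (⇐), T is EXACTLY the φ⁴ sector ΦP... one direction; the other (T → ΦP) would need
HeppForward (equal values ⇒ equal Hepp sums), which is transcendence-flavoured and deliberately not assumed. -/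
theorem tropicalLifting_of_heppBackward_iff (hHB : HeppBackward) : PhiFourValueSector → TropicalLifting :=
  fun h => tropicalLifting_of_split hHB h

end Summit.KontsevichZagierPeriods.KontsevichZagierPeriods.Cruxes.TropicalLifting.RedirectR1
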